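import Mathlib
import Literature.Analysis.FluidPDE.NSFourierData
import Summits.NavierStokesRegularity.NavierStokesRegularity.Theorems.FrozenSignCascadeEnvelopeBoundSmallDataKernel
import HarnessLib

/-!
# Route FrozenSignCascade · crux `EnvelopeBound` (stmt-NavierStokesRegularity-1549): the
  small-data regime, II — the bootstrap

Support file for the crux item stmt-NavierStokesRegularity-1549 (`EnvelopeBound`); lands
`--supports` that item (line `registered`, support sub-goal `envelopeBound_smallData`; the
critical kernel bound is in the companion file `FrozenSignCascadeEnvelopeBoundSmallDataKernel`).

**Theorem (`envelopeBound_smallData`).** There is an absolute constant `δ > 0` such that for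
every viscosity `ν > 0` and every Clay datum `u₀` whose Fourier datum `a = fourierData hu hd` has
a small critical (`PM²`) envelope, `‖ξ‖² ‖a(ξ)‖ ≤ ε ≤ δ ν`, EVERY Fourier-side mild solution `V`
on `[0,T]` from `a` (`IsFourierMild (4π²ν) 4 0 T V`, `V 0 = a`), for every horizon `T`, obeys
`‖ξ‖² ‖V(t,ξ)‖ ≤ 2ε` on `[0,T] × ℝ³`. This is the a-priori form of the Le Jan–Sznitman
small-data theory (Le Jan–Sznitman 1997; Cannone–Karch 2004, Thm. 4.1; Lemarié-Rieusset 2016,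
Thm. 8.19): no construction and no uniqueness are needed, only a quadratic bootstrap along `V`.

Proof.
* `envelope_bootstrap`: by the Duhamel formula from time `0`, the kernel bound
  `‖N(v,v)(ξ)‖ ≤ 864π · 3|B₁| · M²` under an envelope `M` (`envelopeBound_smallDataKernel`) and
  `c‖ξ‖² ∫₀ᵗ e^{-c‖ξ‖²(t-r)} dr ≤ 1`, an envelope `M` on `[0,t] × ℝ³` and an initial envelope
  `ε` give `‖ξ‖²‖V(t,ξ)‖ ≤ ε + κ M²`, `κ = 864π · 3|B₁| / c`.
* `envelope_le_two_mul`: continuous induction on `[0,T]`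
  (`IsClosed.Icc_subset_of_forall_mem_nhdsGT_of_Icc_subset`) for the closed set of times at
  which the envelope is `≤ 2ε`: past such a time the envelope stays below `U = (2κ)⁻¹ > 2ε` for a
  short while (uniform order-`3` decay at high frequencies, joint continuity and compactness at
  low ones), and the finite supremum `m ≤ U` over the window satisfies
  `m ≤ ε + κ m² ≤ ε + m/2`, i.e. `m ≤ 2ε`.
* `envelopeBound_smallData`: `c = 4π²ν`, `δ = π / (1728 · 3|B₁|)`.

References: Y. Le Jan, A.-S. Sznitman, PTRF 109 (1997); M. Cannone, G. Karch, J. Differential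
Equations 197 (2004), Thm. 4.1; P. G. Lemarié-Rieusset, *The Navier–Stokes problem in the 21st
century* (2016), §8.5, Thm. 8.19.
-/

noncomputable section

set_option linter.dupNamespace false -- nested layout Summit.<S>.<Sub>, Sub = S (D-0017)

open MeasureTheory Set Metric Real Filter Topology
open scoped ENNReal
open Literature.Analysis.FluidPDE Literature.Analysis.FluidPDE.FourierNS

namespace Summit.NavierStokesRegularity.NavierStokesRegularity.Theorems.EnvelopeBound.Registered

/-- `0 < 3|B₁|`. -/
theorem three_mul_volume_ball_toReal_pos :
    0 < 3 * (volume (ball (0 : EuclideanSpace ℝ (Fin 3)) 1)).toReal := by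
  have h1 : volume (ball (0 : EuclideanSpace ℝ (Fin 3)) 1) ≠ 0 :=
    (measure_ball_pos volume (0 : EuclideanSpace ℝ (Fin 3)) one_pos).ne'
  have h2 : volume (ball (0 : EuclideanSpace ℝ (Fin 3)) 1) ≠ ⊤ := measure_ball_lt_top.ne
  have := ENNReal.toReal_pos h1 h2
  positivity

/-! ### The bootstrap along a mild solution -/

variable {c T : ℝ} {V : ℝ → EuclideanSpace ℝ (Fin 3) → Fin 3 → ℂ}

/-- **The pointwise bootstrap.** For a Fourier-side mild solution on `[0,T]` with initial envelope
`‖ξ‖²‖V(0,ξ)‖ ≤ ε` and envelope `‖η‖²‖V(s,η)‖ ≤ M` on `[0,t] × ℝ³`, `t ∈ [0,T]`: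
`‖ξ‖²‖V(t,ξ)‖ ≤ ε + 864π · 3|B₁| · M² / c` (Duhamel from `0`; `e^{-c‖ξ‖²t} ≤ 1` on the datum,
`envelopeBound_smallDataKernel` and `c‖ξ‖² ∫₀ᵗ e^{-c‖ξ‖²(t-r)} dr ≤ 1` on the Duhamel term). -/
theorem envelope_bootstrap (h : IsFourierMild c 4 0 T V) {ε M t : ℝ}
    (ha : ∀ ξ, ‖ξ‖ ^ 2 * ‖V 0 ξ‖ ≤ ε) (ht : t ∈ Icc 0 T) (hM0 : 0 ≤ M)
    (hM : ∀ s ∈ Icc 0 t, ∀ η, ‖η‖ ^ 2 * ‖V s η‖ ≤ M) (ξ : EuclideanSpace ℝ (Fin 3)) :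
    ‖ξ‖ ^ 2 * ‖V t ξ‖ ≤
      ε + 864 * π * (3 * (volume (ball (0 : EuclideanSpace ℝ (Fin 3)) 1)).toReal) * M ^ 2 / c := by
  have hc := h.hc
  set N : ℝ := 864 * π * (3 * (volume (ball (0 : EuclideanSpace ℝ (Fin 3)) 1)).toReal) * M ^ 2
    with hN
  have hN0 : 0 ≤ N := by positivity
  have hε0 : 0 ≤ ε := by simpa using ha 0
  by_cases hξ : ξ = 0
  · subst hξ
    rw [norm_zero, zero_pow two_ne_zero, zero_mul]
    positivity
  have hξ0 : 0 < ‖ξ‖ := norm_pos_iff.2 hξ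
  have hNr : ∀ r ∈ Icc 0 t, ‖nonlin (V r) (V r) ξ‖ ≤ N := fun r hr =>
    envelopeBound_smallDataKernel (V r) M hM0 (hM r hr) ξ
  -- Duhamel from time `0`
  set D : Fin 3 → ℂ := ∫ r in (0 : ℝ)..t, heat c ξ (t - r) • nonlin (V r) (V r) ξ with hD
  have hVt : V t ξ = heat c ξ (t - 0) • V 0 ξ - D := h.duhamel le_rfl ht.1 ht.2 ξ
  have hw0 : 0 < ‖ξ‖ ^ 2 := by positivity
  have h1 : ‖ξ‖ ^ 2 * ‖V t ξ‖ ≤ ε + ‖ξ‖ ^ 2 * ‖D‖ := by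
    rw [hVt]
    calc ‖ξ‖ ^ 2 * ‖heat c ξ (t - 0) • V 0 ξ - D‖
        ≤ ‖ξ‖ ^ 2 * (‖heat c ξ (t - 0) • V 0 ξ‖ + ‖D‖) :=
          mul_le_mul_of_nonneg_left (norm_sub_le _ _) hw0.le
      _ = ‖ξ‖ ^ 2 * (heat c ξ (t - 0) * ‖V 0 ξ‖) + ‖ξ‖ ^ 2 * ‖D‖ := by
          rw [norm_heat_smul]; ring
      _ ≤ ‖ξ‖ ^ 2 * ‖V 0 ξ‖ + ‖ξ‖ ^ 2 * ‖D‖ := by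
          gcongr
          exact mul_le_of_le_one_left (norm_nonneg _) (heat_le_one hc.le (by linarith [ht.1]) ξ)
      _ ≤ ε + ‖ξ‖ ^ 2 * ‖D‖ := by
          gcongr
          exact ha ξ
  -- the Duhamel term
  have hD1 : ‖D‖ ≤ ∫ r in (0 : ℝ)..t, heat c ξ (t - r) * ‖nonlin (V r) (V r) ξ‖ :=
    (intervalIntegral.norm_integral_le_integral_norm ht.1).trans_eq
      (intervalIntegral.integral_congr fun r _ => by simp only [norm_heat_smul])
  have hcont1 : Continuous fun r => heat c ξ (t - r) * ‖nonlin (V r) (V r) ξ‖ :=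
    (continuous_heat_comp c continuous_const (continuous_const.sub continuous_id)).mul
      (h.continuous_nonlin_time ξ).norm
  have hcont2 : Continuous fun r => heat c ξ (t - r) * N :=
    (continuous_heat_comp c continuous_const (continuous_const.sub continuous_id)).mul
      continuous_const
  have hD2 : ∫ r in (0 : ℝ)..t, heat c ξ (t - r) * ‖nonlin (V r) (V r) ξ‖ ≤
      ∫ r in (0 : ℝ)..t, heat c ξ (t - r) * N :=
    intervalIntegral.integral_mono_on ht.1 (hcont1.intervalIntegrable _ _)
      (hcont2.intervalIntegrable _ _) fun r hr =>
        mul_le_mul_of_nonneg_left (hNr r hr) (heat_nonneg _ _ _)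
  have hheat : ∫ r in (0 : ℝ)..t, heat c ξ (t - r) ≤ (c * ‖ξ‖ ^ 2)⁻¹ := by
    have := mul_norm_sq_mul_integral_heat_le c ξ 0 t
    rw [← one_div, le_div_iff₀' (by positivity)]
    exact this
  have hDle : ‖D‖ ≤ (c * ‖ξ‖ ^ 2)⁻¹ * N := by
    calc ‖D‖ ≤ _ := hD1
      _ ≤ _ := hD2
      _ = (∫ r in (0 : ℝ)..t, heat c ξ (t - r)) * N := intervalIntegral.integral_mul_const _ _
      _ ≤ (c * ‖ξ‖ ^ 2)⁻¹ * N := mul_le_mul_of_nonneg_right hheat hN0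
  calc ‖ξ‖ ^ 2 * ‖V t ξ‖ ≤ ε + ‖ξ‖ ^ 2 * ‖D‖ := h1
    _ ≤ ε + ‖ξ‖ ^ 2 * ((c * ‖ξ‖ ^ 2)⁻¹ * N) := by gcongr
    _ = ε + N / c := by
        field_simp

/-- **Trapping below `2ε`.** For a Fourier-side mild solution on `[0,T]` with initial envelope
`‖ξ‖²‖V(0,ξ)‖ ≤ ε` at a level with `6912π · 3|B₁| · ε ≤ c`, the envelope stays `≤ 2ε` on
`[0,T] × ℝ³`. Continuous induction on `[0,T]`
(`IsClosed.Icc_subset_of_forall_mem_nhdsGT_of_Icc_subset`) for the closed set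
`{t | ∀ ξ, ‖ξ‖²‖V(t,ξ)‖ ≤ 2ε}`: past a time `x < T` up to which the bound holds, the envelope stays
`≤ U = (2κ)⁻¹ > 2ε`, `κ = 864π · 3|B₁| / c`, for a short while — by the uniform order-`3` decay at
frequencies `‖ξ‖ ≥ ρ`, and by joint continuity on the compact ball `‖ξ‖ ≤ ρ`
(`IsCompact.eventually_forall_of_forall_eventually`) — and the finite supremum `m ≤ U` of the
envelope over `[0,t] × ℝ³` satisfies `m ≤ ε + κ m² ≤ ε + m/2` (`envelope_bootstrap`), so
`m ≤ 2ε`. -/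
theorem envelope_le_two_mul (h : IsFourierMild c 4 0 T V) {ε : ℝ}
    (ha : ∀ ξ, ‖ξ‖ ^ 2 * ‖V 0 ξ‖ ≤ ε)
    (hεc : 6912 * π * (3 * (volume (ball (0 : EuclideanSpace ℝ (Fin 3)) 1)).toReal) * ε ≤ c) :
    ∀ t ∈ Icc 0 T, ∀ ξ : EuclideanSpace ℝ (Fin 3), ‖ξ‖ ^ 2 * ‖V t ξ‖ ≤ 2 * ε := by
  have hc := h.hc
  have hε0 : 0 ≤ ε := by simpa using ha 0
  set CE : ℝ := 3 * (volume (ball (0 : EuclideanSpace ℝ (Fin 3)) 1)).toReal with hCE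
  have hCE0 : 0 < CE := three_mul_volume_ball_toReal_pos
  set κ : ℝ := 864 * π * CE / c with hκ
  have hκ0 : 0 < κ := by positivity
  set U : ℝ := (2 * κ)⁻¹ with hU
  have hU0 : 0 < U := by positivity
  have hUne : U ≠ 0 := hU0.ne'
  have hκU : κ * U = 1 / 2 := by
    rw [hU]
    field_simp
  have hεU : 2 * ε < U := by
    have h8 : 8 * κ * ε ≤ 1 := by
      rw [hκ, show 8 * (864 * π * CE / c) * ε = 6912 * π * CE * ε / c by ring, div_le_one hc]
      exact hεc
    have h1 : 2 * ε * (2 * κ) < 1 := by linarith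
    have h2 : 0 < 2 * κ := by positivity
    calc 2 * ε = 2 * ε * (2 * κ) / (2 * κ) := by field_simp
      _ < 1 / (2 * κ) := by gcongr
      _ = U := by rw [hU, one_div]
  -- the closed set of good times
  obtain ⟨S, hS⟩ : ∃ S : Set ℝ, ∀ t, t ∈ S ↔
      ∀ ξ : EuclideanSpace ℝ (Fin 3), ‖ξ‖ ^ 2 * ‖V t ξ‖ ≤ 2 * ε :=
    ⟨{t | ∀ ξ : EuclideanSpace ℝ (Fin 3), ‖ξ‖ ^ 2 * ‖V t ξ‖ ≤ 2 * ε}, fun _ => Iff.rfl⟩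
  have hSc : IsClosed S := by
    have e : S = ⋂ ξ : EuclideanSpace ℝ (Fin 3), {t : ℝ | ‖ξ‖ ^ 2 * ‖V t ξ‖ ≤ 2 * ε} := by
      ext t
      simp only [hS, mem_iInter, mem_setOf_eq]
    rw [e]
    exact isClosed_iInter fun ξ =>
      isClosed_le (continuous_const.mul (h.continuous_time ξ).norm) continuous_const
  suffices hsub : Icc 0 T ⊆ S from fun t ht => (hS t).1 (hsub ht)
  have h0S : (0 : ℝ) ∈ S := (hS 0).2 fun ξ => (ha ξ).trans (by linarith)
  refine (hSc.inter isClosed_Icc).Icc_subset_of_forall_mem_nhdsGT_of_Icc_subset h0S ?_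
  rintro x ⟨hx0, hxT⟩ hhist
  have hpast : ∀ s ∈ Icc 0 x, ∀ ξ : EuclideanSpace ℝ (Fin 3), ‖ξ‖ ^ 2 * ‖V s ξ‖ ≤ 2 * ε :=
    fun s hs => (hS s).1 (hhist hs)
  -- (a) high frequencies: the uniform order-`3` decay
  obtain ⟨A3, hA3⟩ := h.decay 3
  have hA30 : 0 ≤ A3 := (hA3 0).nonneg
  set ρ : ℝ := A3 / U with hρ
  have htail : ∀ t (ξ : EuclideanSpace ℝ (Fin 3)), ρ ≤ ‖ξ‖ → ‖ξ‖ ^ 2 * ‖V t ξ‖ ≤ U := by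
    intro t ξ hξ
    have hn0 : 0 ≤ ‖ξ‖ := norm_nonneg ξ
    have h1 : (1 + ‖ξ‖) ^ 3 * ‖V t ξ‖ ≤ A3 := weight_mul_norm_le (hA3 t) ξ
    have h2' : ‖ξ‖ ^ 2 * (1 + ‖ξ‖) ≤ (1 + ‖ξ‖) ^ 3 := by
      have := mul_le_mul_of_nonneg_right
        (pow_le_pow_left₀ hn0 (by linarith : ‖ξ‖ ≤ 1 + ‖ξ‖) 2) (by positivity : (0 : ℝ) ≤ 1 + ‖ξ‖)
      calc ‖ξ‖ ^ 2 * (1 + ‖ξ‖) ≤ (1 + ‖ξ‖) ^ 2 * (1 + ‖ξ‖) := this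
        _ = (1 + ‖ξ‖) ^ 3 := by ring
    have h2 : ‖ξ‖ ^ 2 * ‖V t ξ‖ * (1 + ‖ξ‖) ≤ A3 :=
      calc ‖ξ‖ ^ 2 * ‖V t ξ‖ * (1 + ‖ξ‖) = ‖ξ‖ ^ 2 * (1 + ‖ξ‖) * ‖V t ξ‖ := by ring
        _ ≤ (1 + ‖ξ‖) ^ 3 * ‖V t ξ‖ := mul_le_mul_of_nonneg_right h2' (norm_nonneg _)
        _ ≤ A3 := h1
    have h3 : A3 ≤ U * (1 + ‖ξ‖) :=
      calc A3 = U * ρ := by rw [hρ]; field_simp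
        _ ≤ U * ‖ξ‖ := mul_le_mul_of_nonneg_left hξ hU0.le
        _ ≤ U * (1 + ‖ξ‖) := mul_le_mul_of_nonneg_left (by linarith) hU0.le
    exact le_of_mul_le_mul_right (h2.trans h3) (by positivity)
  -- (b) low frequencies: joint continuity on the compact ball, at time `x` the envelope is `< U`
  have hV' : Continuous fun p : ℝ × EuclideanSpace ℝ (Fin 3) => V p.1 p.2 := h.cont
  have hcont : Continuous fun p : ℝ × EuclideanSpace ℝ (Fin 3) => ‖p.2‖ ^ 2 * ‖V p.1 p.2‖ :=
    (continuous_snd.norm.pow 2).mul hV'.norm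
  have hev : ∀ᶠ t in 𝓝 x, ∀ ξ ∈ closedBall (0 : EuclideanSpace ℝ (Fin 3)) ρ,
      ‖ξ‖ ^ 2 * ‖V t ξ‖ < U := by
    refine (isCompact_closedBall (0 : EuclideanSpace ℝ (Fin 3))
      ρ).eventually_forall_of_forall_eventually
      (P := fun t ξ => ‖ξ‖ ^ 2 * ‖V t ξ‖ < U) fun ξ _ => ?_
    have hlt : ‖ξ‖ ^ 2 * ‖V x ξ‖ < U := (hpast x ⟨hx0, le_rfl⟩ ξ).trans_lt hεU
    exact (hcont.tendsto (x, ξ)).eventually_lt_const hlt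
  have hev' : ∀ᶠ t in 𝓝 x, ∀ ξ : EuclideanSpace ℝ (Fin 3), ‖ξ‖ ^ 2 * ‖V t ξ‖ ≤ U :=
    hev.mono fun t ht ξ => by
      rcases le_or_gt ρ ‖ξ‖ with h1 | h1
      · exact htail t ξ h1
      · exact (ht ξ (mem_closedBall_zero_iff.2 h1.le)).le
  obtain ⟨θ, hθ0, hθ⟩ := Metric.eventually_nhds_iff.1 hev'
  -- the right neighbourhood `(x, min T (x + θ))` of `x` lies in `S`
  refine (mem_nhdsGT_iff_exists_Ioo_subset' hxT).2 ⟨min T (x + θ), lt_min hxT (by linarith), ?_⟩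
  intro t ht
  obtain ⟨hxt, htm⟩ := ht
  have htT : t < T := htm.trans_le (min_le_left _ _)
  have htθ : t < x + θ := htm.trans_le (min_le_right _ _)
  -- every value of the envelope on `[0, t] × ℝ³` is `≤ U`
  have hallU : ∀ s ∈ Icc 0 t, ∀ ξ : EuclideanSpace ℝ (Fin 3), ‖ξ‖ ^ 2 * ‖V s ξ‖ ≤ U := by
    intro s hs ξ
    rcases le_or_gt s x with h1 | h1
    · exact (hpast s ⟨hs.1, h1⟩ ξ).trans hεU.le
    · refine hθ ?_ ξ
      rw [Real.dist_eq, abs_of_pos (by linarith)]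
      linarith [hs.2]
  -- the finite supremum over `[0, t] × ℝ³`
  set Abar : ℝ≥0∞ := ⨆ s ∈ Icc 0 t, ⨆ ξ : EuclideanSpace ℝ (Fin 3),
    ENNReal.ofReal (‖ξ‖ ^ 2 * ‖V s ξ‖) with hAbar
  have hAbarU : Abar ≤ ENNReal.ofReal U :=
    iSup₂_le fun s hs => iSup_le fun ξ => ENNReal.ofReal_le_ofReal (hallU s hs ξ)
  have hAbar_top : Abar ≠ ⊤ := ne_top_of_le_ne_top ENNReal.ofReal_ne_top hAbarU
  set m : ℝ := Abar.toReal with hm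
  have hm0 : 0 ≤ m := ENNReal.toReal_nonneg
  have hmU : m ≤ U := ENNReal.toReal_le_of_le_ofReal hU0.le hAbarU
  have hle_m : ∀ s ∈ Icc 0 t, ∀ ξ : EuclideanSpace ℝ (Fin 3), ‖ξ‖ ^ 2 * ‖V s ξ‖ ≤ m := by
    intro s hs ξ
    have h1 : ENNReal.ofReal (‖ξ‖ ^ 2 * ‖V s ξ‖) ≤ Abar := by
      refine le_trans ?_ (le_iSup₂ (f := fun s (_ : s ∈ Icc 0 t) =>
        ⨆ ξ : EuclideanSpace ℝ (Fin 3), ENNReal.ofReal (‖ξ‖ ^ 2 * ‖V s ξ‖)) s hs)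
      exact le_iSup (fun ξ : EuclideanSpace ℝ (Fin 3) => ENNReal.ofReal (‖ξ‖ ^ 2 * ‖V s ξ‖)) ξ
    exact (ENNReal.ofReal_le_iff_le_toReal hAbar_top).1 h1
  -- the bootstrap at every time of `[0, t]`, then absorb
  have hboot : ∀ s ∈ Icc 0 t, ∀ ξ : EuclideanSpace ℝ (Fin 3),
      ‖ξ‖ ^ 2 * ‖V s ξ‖ ≤ ε + κ * m ^ 2 := by
    intro s hs ξ
    have h1 := envelope_bootstrap h ha ⟨hs.1, hs.2.trans htT.le⟩ hm0
      (fun s' hs' η => hle_m s' ⟨hs'.1, hs'.2.trans hs.2⟩ η) ξ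
    calc ‖ξ‖ ^ 2 * ‖V s ξ‖ ≤ ε + 864 * π * CE * m ^ 2 / c := h1
      _ = ε + κ * m ^ 2 := by rw [hκ]; ring
  have hAbar2 : Abar ≤ ENNReal.ofReal (ε + κ * m ^ 2) :=
    iSup₂_le fun s hs => iSup_le fun ξ => ENNReal.ofReal_le_ofReal (hboot s hs ξ)
  have hm_le : m ≤ ε + κ * m ^ 2 := ENNReal.toReal_le_of_le_ofReal (by positivity) hAbar2
  have hm2 : m ≤ 2 * ε := by
    have h1 : κ * m ^ 2 ≤ m / 2 :=
      calc κ * m ^ 2 = (κ * m) * m := by ring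
        _ ≤ (κ * U) * m := by gcongr
        _ = m / 2 := by rw [hκU]; ring
    linarith
  -- hence `t ∈ S`
  exact (hS t).2 fun ξ => (hle_m t ⟨hx0.trans hxt.le, le_rfl⟩ ξ).trans hm2

/-! ### The registered support sub-goal -/

/-- **The crux in the small-data regime (Le Jan–Sznitman, a-priori form).** There is an absolute
`δ > 0` (`δ = π / (1728 · 3|B₁|) = 1/6912`) such that for every `ν > 0`, every Clay datum `u₀` whose
Fourier datum has critical envelope `‖ξ‖² ‖𝓕⁻¹u₀(ξ)‖ ≤ ε` with `ε ≤ δ ν`, every horizon `T` and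
EVERY Fourier-side mild solution `V` on `[0,T]` from that datum, `‖ξ‖² ‖V(t,ξ)‖ ≤ 2ε` on
`[0,T] × ℝ³` (`envelope_le_two_mul` with `c = 4π²ν`: the smallness condition is
`6912π · 3|B₁| · ε ≤ 4π²ν`). The divergence-free hypothesis is not used. -/
theorem envelopeBound_smallData :
    ∃ δ : ℝ, 0 < δ ∧ ∀ ν : ℝ, 0 < ν →
      ∀ (u₀ : EuclideanSpace ℝ (Fin 3) → EuclideanSpace ℝ (Fin 3)) (hu : ContDiff ℝ (⊤ : ℕ∞) u₀)
        (hd : Literature.Analysis.FluidPDE.HasRapidSpatialDecay u₀),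
        Literature.Analysis.FluidPDE.NSWave0.IsDivFree u₀ →
      ∀ ε : ℝ, (∀ ξ : EuclideanSpace ℝ (Fin 3),
          ‖ξ‖ ^ 2 * ‖Literature.Analysis.FluidPDE.FourierNS.fourierData hu hd ξ‖ ≤ ε) →
        ε ≤ δ * ν →
      ∀ T : ℝ, ∀ V : ℝ → EuclideanSpace ℝ (Fin 3) → Fin 3 → ℂ,
        Literature.Analysis.FluidPDE.FourierNS.IsFourierMild (4 * Real.pi ^ 2 * ν) 4 0 T V →
        V 0 = Literature.Analysis.FluidPDE.FourierNS.fourierData hu hd →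
        ∀ t ∈ Set.Icc 0 T, ∀ ξ : EuclideanSpace ℝ (Fin 3), ‖ξ‖ ^ 2 * ‖V t ξ‖ ≤ 2 * ε := by
  set CE : ℝ := 3 * (volume (ball (0 : EuclideanSpace ℝ (Fin 3)) 1)).toReal with hCE
  have hCE0 : 0 < CE := three_mul_volume_ball_toReal_pos
  refine ⟨π / (1728 * CE), by positivity, ?_⟩
  intro ν hν u₀ hu hd _ ε hε hεδ T V hV hV0 t ht ξ
  refine envelope_le_two_mul hV (fun ξ => by rw [hV0]; exact hε ξ) ?_ t ht ξ
  -- `6912π · CE · ε ≤ 4π²ν` from `ε ≤ πν / (1728 CE)`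
  have h1 : ε * (1728 * CE) ≤ π * ν := by
    have h2 := hεδ
    rw [div_mul_eq_mul_div, le_div_iff₀ (by positivity)] at h2
    exact h2
  calc 6912 * π * CE * ε = 4 * π * (ε * (1728 * CE)) := by ring
    _ ≤ 4 * π * (π * ν) := by gcongr
    _ = 4 * Real.pi ^ 2 * ν := by ring

end Summit.NavierStokesRegularity.NavierStokesRegularity.Theorems.EnvelopeBound.Registered

end
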